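import Mathlib
import HarnessLib
import Literature.AlgebraicGeometry.Resolution.BlowupPrincipalCharts

/-!
# S1a — (S2) the principal charts at a RADICAL generating family cover `π⁻¹(U)`; Rees algebras along a ring iso

[OURS · L1 W4.5c · lead-1 g6] — NOT a statement of the manuscript; counted 0; AI-level work, weaker than expert
review. Crux stmt-ResolutionOfSingularities-17941 (`WildQuotients.CyclicQuotientFourfolds`), line `s1a-logminvertex`,
stub `stub_localGame` (producer); A5b design `Cruxes/CyclicQuotientFourfolds/Lines/s1a-logminvertex-A5B-DESIGN.md`
(S2)+(N2), plan-1 RULING 22:26:15Z. The treeʼs `IsBlowup.iSup_blowupChart` needs GENERATORS of `I(U)`; the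
σ-invariant normalised cover of `…S1aCoverNormalisation`/`…S1aCoverTransfer` only gives elements `y_j` whose Rees
elements `y_j t` generate the irrelevant ideal UP TO RADICAL. This file supplies the radical versions and the
transport of Rees algebras along a ring isomorphism (the node iso `e : Γ(V, O) ≃+* 𝒜 0`):

* `Proj.iSup_basicOpen_eq_top_of_le_radical` — `D₊(fᵢ)` cover `Proj A` as soon as `A₊ ≤ √(span fᵢ)`;
* `affineBlowup.iSup_chartOpen_eq_top_of_radical`, **`IsBlowup.iSup_blowupChart_of_radical`** — the principal
  charts `X'[U, x_k]` cover `π⁻¹ U` as soon as every `b t`, `b ∈ I(U)`, lies in `√(span {x_k t})` in `Rees(I(U))`;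
* `reesMap` — a ring iso `e : R ≃+* S` with `e.symm '' J ⊆ J'` … precisely `J.map e.symm ≤ J'` induces
  `Rees_S(J) →+* Rees_R(J')`, `reesT y ↦ reesT (e.symm y)` (`reesMap_reesT`), so radical-membership statements
  transport (`reesT_mem_radical_span_of_equiv`).
-/

set_option linter.dupNamespace false

noncomputable section

open CategoryTheory AlgebraicGeometry TopologicalSpace Polynomial
open Literature.AlgebraicGeometry.Resolution

namespace Summit.ResolutionOfSingularities.ResolutionOfSingularities.Theorems.WildQuotientResolution.S1.BlowupCharts

universe u

/-! ## `Proj`: basic opens at a radical generating family cover -/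

/-- If the irrelevant ideal lies in the RADICAL of the ideal spanned by the `fᵢ`, the `D₊(fᵢ)` cover `Proj`. -/
theorem Proj.iSup_basicOpen_eq_top_of_le_radical {σ A : Type*} [CommRing A] [SetLike σ A] [AddSubgroupClass σ A]
    (𝒜 : ℕ → σ) [GradedRing 𝒜] {ι : Type*} (f : ι → A)
    (hf : (HomogeneousIdeal.irrelevant 𝒜).toIdeal ≤ (Ideal.span (Set.range f)).radical) :
    ⨆ i, Proj.basicOpen 𝒜 (f i) = ⊤ := by
  classical
  refine top_le_iff.mp fun x _ ↦ TopologicalSpace.Opens.mem_iSup.mpr ?_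
  by_contra! H
  simp only [Proj.mem_basicOpen, Decidable.not_not] at H
  refine x.not_irrelevant_le (hf.trans ?_)
  have hle : Ideal.span (Set.range f) ≤ x.asHomogeneousIdeal.toIdeal := by
    rw [Ideal.span_le, Set.range_subset_iff]; exact H
  intro a ha
  exact (x.isPrime.radical_le_iff.mpr hle) ha

/-! ## Affine blow-ups: charts at a radical generating family cover -/

section Affine

variable {R : Type u} [CommRing R] {I : Ideal R}

/-- **The charts `D₊(x_k t)` cover `Bl_I(Spec R)` as soon as every `b t`, `b ∈ I`, lies in `√(span {x_k t})`.**
[OURS · L1 W4.5c] -/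
theorem affineBlowup.iSup_chartOpen_eq_top_of_radical {κ : Type*} (x : κ → R) (hx : ∀ k, x k ∈ I)
    (hrad : ∀ (b : R) (hb : b ∈ I), reesT b hb ∈ (Ideal.span (Set.range fun k => reesT (x k) (hx k))).radical) :
    ⨆ k, (affineBlowup.chartOpen (I := I) (x k) (hx k) : (affineBlowup I).Opens) = ⊤ := by
  have : ∀ k, (affineBlowup.chartOpen (I := I) (x k) (hx k) : (affineBlowup I).Opens) =
      Proj.basicOpen (reesGrading I) (reesT (x k) (hx k)) :=
    fun k => affineBlowup.image_top_chartι _ _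
  simp_rw [this]
  refine Proj.iSup_basicOpen_eq_top_of_le_radical (reesGrading I) _ ((irrelevant_le_span_reesT I).trans ?_)
  rw [Ideal.span_le]
  rintro _ ⟨c, rfl⟩
  exact hrad c.1 c.2

end Affine

/-! ## Blow-ups: principal charts at a radical generating family cover `π⁻¹ U` -/

section Blowup

variable {X' X : Scheme.{u}} {π : X' ⟶ X} {I : X.IdealSheafData} (hπ : IsBlowup π I) {U : X.affineOpens}

include hπ in
/-- **The principal charts `X'[U, x_k]` cover `π⁻¹(U)` as soon as the `x_k t` generate the irrelevant ideal of
`Rees(I(U))` up to radical.** [OURS · L1 W4.5c] -/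
theorem IsBlowup.iSup_blowupChart_of_radical {κ : Type*} (x : κ → Γ(X, U)) (hx : ∀ k, x k ∈ I.ideal U)
    (hrad : ∀ (b : Γ(X, U)) (hb : b ∈ I.ideal U),
      reesT b hb ∈ (Ideal.span (Set.range fun k => reesT (x k) (hx k))).radical) :
    ⨆ k, blowupChart π I U (x k) = π ⁻¹ᵁ (U : X.Opens) := by
  obtain ⟨φ, _, hφ, hrange⟩ := hπ.exists_chartImmersion U
  have : ∀ k, blowupChart π I U (x k) = φ ''ᵁ affineBlowup.chartOpen (x k) (hx k) := fun k =>
    hπ.blowupChart_eq_image φ hφ hrange (x k) (hx k)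
  simp_rw [this]
  rw [← Scheme.Hom.image_iSup, affineBlowup.iSup_chartOpen_eq_top_of_radical x hx hrad,
    Scheme.Hom.image_top_eq_opensRange, hrange]

end Blowup

/-! ## Rees algebras along a ring isomorphism -/

section ReesMap

variable {R S : Type u} [CommRing R] [CommRing S] (e : R ≃+* S) (J' : Ideal R) (J : Ideal S)
  (hJ : J.map (e.symm : S →+* R) ≤ J')

include hJ in
/-- Coefficientwise `e⁻¹` maps `Rees_S(J)` into `Rees_R(J')`. -/
theorem map_symm_mem_reesAlgebra (p : ↥(reesAlgebra J)) :
    Polynomial.map (e.symm : S →+* R) (p : S[X]) ∈ reesAlgebra J' := by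
  rw [mem_reesAlgebra_iff]
  intro i
  rw [Polynomial.coeff_map]
  have hp := (mem_reesAlgebra_iff _ _).mp p.2 i
  have : (J ^ i).map (e.symm : S →+* R) ≤ J' ^ i := by
    rw [Ideal.map_pow]; exact Ideal.pow_right_mono hJ i
  exact this (Ideal.mem_map_of_mem _ hp)

/-- **`Rees_S(J) → Rees_R(J')`** induced by `e⁻¹` (when `e⁻¹(J) ⊆ J'`). [OURS · L1 W4.5c] -/
def reesMap : ↥(reesAlgebra J) →+* ↥(reesAlgebra J') :=
  ((Polynomial.mapRingHom (e.symm : S →+* R)).comp (reesAlgebra J).val.toRingHom).codRestrict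
    (reesAlgebra J').toSubring (map_symm_mem_reesAlgebra e J' J hJ)

/-- Underlying polynomial of `reesMap p`. -/
@[simp] theorem coe_reesMap (p : ↥(reesAlgebra J)) :
    ((reesMap e J' J hJ p : ↥(reesAlgebra J')) : R[X]) = Polynomial.map (e.symm : S →+* R) (p : S[X]) :=
  rfl

/-- `reesMap (y t) = (e⁻¹ y) t`. -/
theorem reesMap_reesT (y : S) (hy : y ∈ J) (hy' : e.symm y ∈ J') :
    reesMap e J' J hJ (reesT y hy) = reesT (e.symm y) hy' := by
  refine Subtype.ext ?_
  rw [coe_reesMap, coe_reesT, coe_reesT, Polynomial.map_monomial]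
  rfl

include hJ in
/-- **Transport of radical membership**: if `y t ∈ √(span {y_j t})` in `Rees_S(J)` then
`(e⁻¹ y) t ∈ √(span {(e⁻¹ y_j) t})` in `Rees_R(J')`. [OURS · L1 W4.5c] -/
theorem reesT_mem_radical_span_of_equiv {L : ℕ} (yj : Fin L → S) (hyj : ∀ j, yj j ∈ J)
    (hyj' : ∀ j, e.symm (yj j) ∈ J') (y : S) (hy : y ∈ J) (hy' : e.symm y ∈ J')
    (h : reesT y hy ∈ (Ideal.span (Set.range fun j => reesT (yj j) (hyj j))).radical) :
    reesT (e.symm y) hy' ∈ (Ideal.span (Set.range fun j => reesT (e.symm (yj j)) (hyj' j))).radical := by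
  obtain ⟨n, hn⟩ := h
  refine ⟨n, ?_⟩
  have := Ideal.mem_map_of_mem (reesMap e J' J hJ) hn
  rw [map_pow, reesMap_reesT e J' J hJ y hy hy', Ideal.map_span, ← Set.range_comp] at this
  have hfun : ((reesMap e J' J hJ) ∘ fun j => reesT (yj j) (hyj j)) = fun j => reesT (e.symm (yj j)) (hyj' j) :=
    funext fun j => reesMap_reesT e J' J hJ (yj j) (hyj j) (hyj' j)
  rwa [hfun] at this

end ReesMap

end Summit.ResolutionOfSingularities.ResolutionOfSingularities.Theorems.WildQuotientResolution.S1.BlowupCharts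

end
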